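import Mathlib
import HarnessLib
import Summits.Ventures.LatticeQCDFlow.Exactness.SUNMultiStepPositionLaw
import Summits.Ventures.LatticeQCDFlow.Exactness.SUNMultiStepThreshold
import Summits.Ventures.LatticeQCDFlow.Exactness.SUNLeapfrogHMCErgodic

/-!
# Multi-step leapfrog HMC on `SU(N)` lattice gauge fields is uniformly ergodic for short trajectories (a power of the kernel is Doeblin)

HONEST FRAMING: exact (Metropolis-corrected) sampling algorithms for lattice gauge theory;
figures of merit are autocorrelation/cost numbers at stated couplings and volumes; no
continuum-physics claim.

Venture `LatticeQCDFlow` (cell pub-lqcd), topic `Exactness`, FANOUT row 9 (eng-latcore, the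
engine `latflow.core.hmc.HMC(f, β, 'leapfrog').trajectory(τ, nstep)` / `sun_2d.HMC2D` on `SU(N)`
with `nstep ≥ 2` — the row every `SU(N)` exactness file of the tree listed as NOT CLAIMED).  NEW WORK
of the cell over the tree (`SUNMultiStepLeapfrogHMC.lean`: the kernel `sunLeapfrogHMCN`, exact at every
`nstep`; `SUNMultiStepPositionLaw.lean`: the position law dominates the chart kick;
`SUNMultiStepThreshold.lean`: the threshold `s(ι)`; `SUNProductTrajectory.plfBounds_sun`;
`SUNLeapfrogHMCWalk.refreshUpdate_involMH_minorised_at`, `smul_restrict_sunMomBox_le_sunMomentumLaw`;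
`SUNExpChartMinorisation.sunKick_nHit_minorised`; `PiGroupKicks`, `MetropolisSweepErgodic`,
`MetropolisSweepConvergence.uniformlyErgodic_of_nHit_minorised`, `DoeblinUniqueness`,
`LocalDilationPushforward.exists_addHaar_image_le_of_lipschitzOnWith`); nothing here is cited as a
fact.  Printed counterparts, NAMED ONLY: Duane–Kennedy–Pendleton–Roweth 1987; Mackenzie 1989 (long
fixed-length trajectories can be non-ergodic — nothing is asserted there); Bou-Rabee–Sanz-Serna 2018
(irreducibility of HMC for short trajectories); Meyn–Tweedie ch. 16.

THE SETTING.  Coordinates `ι : E → 𝔰𝔲(N)` (injective, onto; `N ≥ 1`), any additive Haar measure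
`μ` on `E`, any measurable kinetic term `T ≥ 0` bounded on boxes with `Z_T < ∞` (the engine's Gaussian
is one), any measurable action `S` bounded by `s`, a measurable momentum increment `g` (in the engine
`−½ε∂S`) bounded by `b` per link and `K_g`-Lipschitz in the matrix sup norm, step `ε > 0`, `n ≥ 1` steps.
THE HYPOTHESIS (short trajectories): `nε ≤ s(ι)`, `(2n+1)b ≤ s(ι)`, `K_g·ε·n² ≤ s(ι)` with the positive
threshold `s(ι) = sunShortTrajThreshold ι hinj` of the coordinates.

* **`sunLeapfrogHMCN_minorised_walk`** — from EVERY configuration `U`, one `n`-step HMC update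
  dominates `δ₁ · ((⊗ chartKickR (nε/3)) · U)`, `δ₁ > 0` not depending on `U`.
* **`sunLeapfrogHMCN_nHit_minorised`** — some power `K^{k+1}` dominates `δ · Haar^{⊗links}` from every
  start (the chart kick covers, link by link; products; right invariance).
* **`sunLeapfrogHMCN_uniformlyErgodic`** — `|μ₀Kᵗ(A) − π_S(A)| ≤ (1 − δ)^{⌊t/(k+1)⌋}` for EVERY initial
  law, `π_S = gibbsProbability Haar^{⊗links} e^{−S}` (`= Z_S⁻¹e^{−S}·Haar^⊗`);
  **`sunLeapfrogHMCN_invariant_unique`** — `π_S` is the ONLY invariant probability law.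

NOT CLAIMED: anything when the hypothesis fails (in particular the engine's usual `τ = nε ≈ 1`: long
fixed-length trajectories can be non-ergodic, Mackenzie 1989); any usable constant (`s(ι)`, `k`, `δ`
come from the inverse function theorem and compactness); OMF words / `tau_jitter` (row 14's
calculus); `CP(N−1)` / spheres; floating point.
-/

noncomputable section

namespace Summit.Ventures.LatticeQCDFlow.Exactness

open MeasureTheory ProbabilityTheory ProbabilityTheory.Kernel Set Metric Function NormedSpace Filter Topology
open Literature.MathematicalPhysics.QuantumFieldTheory (haarProbability)
open scoped ENNReal Matrix Matrix.Norms.Operator NNReal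

set_option backward.isDefEq.respectTransparency false

section SUN

variable {n : Type*} [Fintype n] [DecidableEq n] [Nonempty n]
variable {E : Type*} [NormedAddCommGroup E] [NormedSpace ℝ E] [MeasurableSpace E] [BorelSpace E]
  [FiniteDimensional ℝ E]
variable (ι : E →ₗ[ℝ] Matrix n n ℂ) (hι : ∀ a, (ι a)ᴴ = -ι a ∧ (ι a).trace = 0) (hinj : Injective ι)
variable {L : Type*} [Fintype L] (μ : Measure E) [μ.IsAddHaarMeasure]
variable {T : (L → E) → ℝ} {τ : ℝ → ℝ} {g : (L → Matrix.specialUnitaryGroup n ℂ) → L → E}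

omit [NormedSpace ℝ E] [MeasurableSpace E] [BorelSpace E] [FiniteDimensional ℝ E] in
/-- The unit momentum ball lies in the box of radius `2`. -/
theorem closedBall_subset_sunMomBox : closedBall (0 : L → E) 1 ⊆ sunMomBox (L := L) (E := E) 2 :=
  fun p hp l _ => mem_ball_zero_iff.2 (lt_of_le_of_lt ((norm_le_pi_norm p l).trans (mem_closedBall_zero_iff.1 hp)) (by norm_num))

omit [DecidableEq n] [MeasurableSpace E] [BorelSpace E] in
/-- The exponential defect used is at most `1`. -/
theorem sunExpDefect_le_one : sunExpDefect (n := n) ι hinj ≤ 1 := by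
  unfold sunExpDefect
  have hD := one_le_sunCoordDistortion ι hinj
  have hN : (1 : ℝ) ≤ Fintype.card n := by exact_mod_cast Fintype.card_pos
  rw [div_le_one (by positivity)]; nlinarith

omit [DecidableEq n] [Nonempty n] [MeasurableSpace E] [BorelSpace E] in
/-- The logarithm defect used is at most `1`. -/
theorem sunLogDefect_le_one : sunLogDefect (n := n) ι hinj ≤ 1 := by
  unfold sunLogDefect
  have hD := one_le_sunCoordDistortion ι hinj
  rw [div_le_one (by positivity)]; linarith

/-! ## §1 One `n`-step update dominates the configuration kicked by the chart kick of radius `nε/3` -/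

/-- **`K_n(U, ·) ≥ δ₁ · (⊗ chartKickR (nε/3))·U` FROM EVERY CONFIGURATION `U`**, for short trajectories:
`ε > 0`, `n ≥ 1`, a measurable kinetic term `T ≥ 0` bounded by `τ_T` on boxes with `Z_T < ∞`, a
measurable increment bounded by `b ≥ 0` per link and `K_g`-Lipschitz (`K_g ≥ 0`) in the matrix sup norm,
a measurable action bounded by `s`, and `nε, (2n+1)b, K_g εn² ≤ s(ι)`. -/
theorem sunLeapfrogHMCN_minorised_walk
    (hsurj : ∀ X : Matrix n n ℂ, Xᴴ = -X → X.trace = 0 → X ∈ LinearMap.range ι)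
    {ε : ℝ} (hε : 0 < ε) {N : ℕ} (hN : 1 ≤ N) (hT : Measurable T) (hT0 : ∀ p, 0 ≤ T p)
    (hTle : ∀ (R : ℝ) (p : L → E), (∀ l, ‖p l‖ ≤ R) → T p ≤ τ R) (hZ : sunMomentumWeight (L := L) μ T univ ≠ ⊤)
    (hg : Measurable g) {b Kg : ℝ} (hb0 : 0 ≤ b) (hb : ∀ u l, ‖g u l‖ ≤ b) (hK0 : 0 ≤ Kg)
    (hK : ∀ U U', ‖g U - g U'‖ ≤ Kg * ‖coeConfig U - coeConfig U'‖)
    {S : (L → Matrix.specialUnitaryGroup n ℂ) → ℝ} (hS : Measurable S) {s : ℝ} (hs : ∀ u, |S u| ≤ s)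
    (h1 : N * ε ≤ sunShortTrajThreshold ι hinj) (h2 : (2 * N + 1) * b ≤ sunShortTrajThreshold ι hinj)
    (h3 : Kg * ε * (N : ℝ) ^ 2 ≤ sunShortTrajThreshold ι hinj) :
    ∃ δ : ℝ≥0∞, 0 < δ ∧ ∀ u, δ • mulWalk (Measure.pi fun _ : L => chartKickR ι hι μ (N * ε / 3)) u ≤
      sunLeapfrogHMCN ι hι ε μ T hg S N u := by
  classical
  -- the threshold package and the radii
  obtain ⟨hT1, hT2a, hT2b, hT3, hT4⟩ := sunShortTraj_package ι hinj (L := L) hN hε hb0 hK0 h1 h2 h3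
  have hρ := sunExpRadius_spec (n := n) ι hinj
  have hρL := sunLogRadius_spec (n := n) ι hinj
  have hdefL := linkExp_defect_of_matrix (L := L) (sunExpDefect_pos ι hinj).le hρ.2
  have hlogL := linkLog_defect_of_matrix (L := L) (sunLogDefect_pos ι hinj).le hρL.2.1
  -- the Lipschitz image constant of `μ^{⊗links}`, made positive
  obtain ⟨A, hA⟩ := exists_addHaar_image_le_of_lipschitzOnWith (Measure.pi fun _ : L => μ)
  have hA' : ∀ (K' : ℝ≥0) (f : (L → E) → L → E) (s' : Set (L → E)), LipschitzOnWith K' f s' →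
      Measure.pi (fun _ : L => μ) (f '' s') ≤ (((A + 1) * K' : ℝ≥0) : ℝ≥0∞) ^ Module.finrank ℝ (L → E) *
        Measure.pi (fun _ : L => μ) s' := fun K' f s' hf =>
    (hA K' f s' hf).trans (by gcongr; exact le_self_add)
  -- constants
  set cbox : ℝ≥0∞ := (sunMomentumWeight (L := L) μ T univ)⁻¹ * ENNReal.ofReal (Real.exp (-τ 2)) with hcbox
  set B : ℝ := 2 * s + τ (1 + 2 * ((N : ℝ) + 1) * b) with hB
  set cpos : ℝ≥0∞ := (((((A + 1) * Real.toNNReal (N * ε + N * ε / 3) : ℝ≥0) : ℝ≥0∞) ^ Module.finrank ℝ (L → E))⁻¹ *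
      μ (ball (0 : E) (N * ε / 3)) ^ Fintype.card L) with hcpos
  have hH : Measurable fun z : (L → Matrix.specialUnitaryGroup n ℂ) × (L → E) => S z.1 + T z.2 :=
    (hS.comp measurable_fst).add (hT.comp measurable_snd)
  have hs0 : 0 ≤ s := (abs_nonneg _).trans (hs fun _ => 1)
  have hτ0 : 0 ≤ τ (1 + 2 * ((N : ℝ) + 1) * b) :=
    (hT0 0).trans (hTle _ 0 fun l => by simp only [Pi.zero_apply, norm_zero]; positivity)
  have hB0 : 0 ≤ B := by positivity
  have hcbox0 : cbox ≠ 0 := mul_ne_zero (ENNReal.inv_ne_zero.2 hZ) (ENNReal.ofReal_pos.2 (Real.exp_pos _)).ne'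
  have hN0 : (0 : ℝ) < N := Nat.cast_pos.2 hN
  have hr : 0 < (N : ℝ) * ε / 3 := by positivity
  have hcpos0 : cpos ≠ 0 := mul_ne_zero (ENNReal.inv_ne_zero.2 (ENNReal.pow_ne_top ENNReal.coe_ne_top))
    (pow_ne_zero _ (measure_ball_pos μ _ hr).ne')
  refine ⟨ENNReal.ofReal (Real.exp (-B)) * (cbox * cpos), ?_, fun u => ?_⟩
  · exact ENNReal.mul_pos (ENNReal.ofReal_pos.2 (Real.exp_pos _)).ne' (mul_ne_zero hcbox0 hcpos0)
  -- the standing hypotheses at base `u`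
  have hPLF := plfBounds_sun ι hι (u := u) (g := g) hb0 hb hK0 hK hρ.1 (sunExpDefect_pos ι hinj)
    (sunExpDefect_le_one ι hinj) hdefL
  have hΦ : Measurable fun p : L → E => (sunLeapfrogProposalN ι hι ε g N (u, p)).1 :=
    measurable_fst.comp ((measurable_sunLeapfrogProposalN ι hι ε N hg).comp measurable_prodMk_left)
  -- the refresh minorant at `u`
  refine refreshUpdate_involMH_minorised_at (measurable_sunLeapfrogProposalN ι hι ε N hg) hH (sunMomentumLaw μ T)
    (ρ := cbox • (Measure.pi fun _ : L => μ).restrict (closedBall (0 : L → E) 1)) ?_ u ?_ ?_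
  · exact (measure_smul_le_smul_of_le (Measure.restrict_mono closedBall_subset_sunMomBox le_rfl) cbox).trans
      (smul_restrict_sunMomBox_le_sunMomentumLaw μ T τ hTle 2)
  · exact Measure.ae_smul_measure ((ae_restrict_iff' measurableSet_closedBall).2
      (Filter.Eventually.of_forall fun p hp => le_involAcceptE_of_le hB0
        (sunLeapfrogN_energy_window ι hι hPLF hT0 hTle hs (mem_closedBall_zero_iff.1 hp) N))) _
  · refine Measure.le_iff.2 fun A' hA'm => ?_
    have hlaw := sunLeapfrogProposalN_position_law ι hι hinj μ hsurj hPLF hε hN hT1 hT2a hT2b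
      (sunLogDefect_pos ι hinj).le (sunLogDefect_le_one ι hinj) hlogL hρL.2.2 hT3 hT4 (A := A + 1) (by simp) hA' hA'm
    rw [Measure.smul_apply, smul_eq_mul, Measure.map_apply hΦ hA'm, Measure.smul_apply, smul_eq_mul,
      Measure.restrict_apply (hΦ hA'm), mul_assoc]
    exact mul_le_mul' le_rfl hlaw

/-! ## §2 A power of the kernel is Doeblin: uniform ergodicity and uniqueness -/

/-- **A POWER OF `n`-STEP LEAPFROG HMC ON `SU(N)^links` IS DOEBLIN** (short trajectories): there are
`k` and `δ > 0` with `K_n^{k+1}(U, ·) ≥ δ · Haar^{⊗links}` from EVERY `U`. -/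
theorem sunLeapfrogHMCN_nHit_minorised
    (hsurj : ∀ X : Matrix n n ℂ, Xᴴ = -X → X.trace = 0 → X ∈ LinearMap.range ι)
    {ε : ℝ} (hε : 0 < ε) {N : ℕ} (hN : 1 ≤ N) (hT : Measurable T) (hT0 : ∀ p, 0 ≤ T p)
    (hTle : ∀ (R : ℝ) (p : L → E), (∀ l, ‖p l‖ ≤ R) → T p ≤ τ R) (hZ : sunMomentumWeight (L := L) μ T univ ≠ ⊤)
    (hg : Measurable g) {b Kg : ℝ} (hb0 : 0 ≤ b) (hb : ∀ u l, ‖g u l‖ ≤ b) (hK0 : 0 ≤ Kg)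
    (hK : ∀ U U', ‖g U - g U'‖ ≤ Kg * ‖coeConfig U - coeConfig U'‖)
    {S : (L → Matrix.specialUnitaryGroup n ℂ) → ℝ} (hS : Measurable S) {s : ℝ} (hs : ∀ u, |S u| ≤ s)
    (h1 : N * ε ≤ sunShortTrajThreshold ι hinj) (h2 : (2 * N + 1) * b ≤ sunShortTrajThreshold ι hinj)
    (h3 : Kg * ε * (N : ℝ) ^ 2 ≤ sunShortTrajThreshold ι hinj) :
    ∃ k : ℕ, ∃ δ : ℝ≥0∞, 0 < δ ∧ ∀ u,
      δ • Measure.pi (fun _ : L => haarProbability (Matrix.specialUnitaryGroup n ℂ)) ≤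
        nHit (sunLeapfrogHMCN ι hι ε μ T hg S N) (k + 1) u := by
  classical
  obtain ⟨δ₁, hδ₁, hwalk⟩ := sunLeapfrogHMCN_minorised_walk ι hι hinj μ hsurj hε hN hT hT0 hTle hZ hg hb0 hb hK0 hK hS hs h1 h2 h3
  have hN0 : (0 : ℝ) < N := Nat.cast_pos.2 hN
  have hr : 0 < (N : ℝ) * ε / 3 := by positivity
  haveI := isProbabilityMeasure_chartKickR ι hι μ hr
  -- the chart kick of radius `nε/3` covers on one link
  have hcb : (μ (ball (0 : E) (N * ε / 3)))⁻¹ ≠ 0 := ENNReal.inv_ne_zero.2 measure_ball_lt_top.ne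
  obtain ⟨k, δ', hδ', hcov⟩ := sunKick_nHit_minorised ι hι hinj hsurj μ (ball_mem_nhds (0 : E) hr)
    (ν := chartKickR ι hι μ (N * ε / 3)) hcb le_rfl
  refine ⟨k, δ₁ ^ (k + 1) * δ' ^ Fintype.card L, ENNReal.mul_pos (pow_ne_zero _ hδ₁.ne') (pow_ne_zero _ hδ'.ne'),
    fun u => ?_⟩
  have hpow := smul_nHit_le_nHit hwalk (k + 1) u
  rw [nHit_mulWalk, mconvPow_pi_succ] at hpow
  have hcoord : δ' • haarProbability (Matrix.specialUnitaryGroup n ℂ) ≤ mconvPow (chartKickR ι hι μ (N * ε / 3)) (k + 1) :=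
    smul_haar_le_mconvPow hcov (Nat.le_succ k)
  have hpi : δ' ^ Fintype.card L • Measure.pi (fun _ : L => haarProbability (Matrix.specialUnitaryGroup n ℂ)) ≤
      Measure.pi fun _ : L => mconvPow (chartKickR ι hι μ (N * ε / 3)) (k + 1) := by
    have h := smul_pi_le_pi (c := fun _ : L => δ') fun _ : L => hcoord
    rwa [Finset.prod_const, Finset.card_univ] at h
  have hmul : δ' ^ Fintype.card L • Measure.pi (fun _ : L => haarProbability (Matrix.specialUnitaryGroup n ℂ)) ≤
      mulWalk (Measure.pi fun _ : L => mconvPow (chartKickR ι hι μ (N * ε / 3)) (k + 1)) u := by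
    rw [mulWalk_apply]
    have h := Measure.map_mono hpi (measurable_mul_const u)
    rwa [Measure.map_smul, map_mul_right_eq_self] at h
  calc (δ₁ ^ (k + 1) * δ' ^ Fintype.card L) • Measure.pi (fun _ : L => haarProbability (Matrix.specialUnitaryGroup n ℂ))
      = δ₁ ^ (k + 1) • (δ' ^ Fintype.card L • Measure.pi (fun _ : L => haarProbability (Matrix.specialUnitaryGroup n ℂ))) := by
        rw [mul_smul]
    _ ≤ δ₁ ^ (k + 1) • mulWalk (Measure.pi fun _ : L => mconvPow (chartKickR ι hι μ (N * ε / 3)) (k + 1)) u :=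
        measure_smul_le_smul_of_le hmul _
    _ ≤ nHit (sunLeapfrogHMCN ι hι ε μ T hg S N) (k + 1) u := hpow

/-- **MULTI-STEP LEAPFROG HMC ON `SU(N)^links` IS UNIFORMLY ERGODIC FOR SHORT TRAJECTORIES.**  Same
hypotheses; then there are `k` and `δ ∈ (0, 1]` with `|μ₀Kᵗ(A) − π_S(A)| ≤ (1 − δ)^{⌊t/(k+1)⌋}` for
EVERY initial law `μ₀`, every `t`, every `A`, `π_S = gibbsProbability Haar^{⊗links} e^{−S}`. -/
theorem sunLeapfrogHMCN_uniformlyErgodic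
    (hsurj : ∀ X : Matrix n n ℂ, Xᴴ = -X → X.trace = 0 → X ∈ LinearMap.range ι)
    {ε : ℝ} (hε : 0 < ε) {N : ℕ} (hN : 1 ≤ N) (hT : Measurable T) (hT0 : ∀ p, 0 ≤ T p)
    (hTle : ∀ (R : ℝ) (p : L → E), (∀ l, ‖p l‖ ≤ R) → T p ≤ τ R) (hZ : sunMomentumWeight (L := L) μ T univ ≠ ⊤)
    (hg : Measurable g) {b Kg : ℝ} (hb0 : 0 ≤ b) (hb : ∀ u l, ‖g u l‖ ≤ b) (hK0 : 0 ≤ Kg)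
    (hK : ∀ U U', ‖g U - g U'‖ ≤ Kg * ‖coeConfig U - coeConfig U'‖)
    {S : (L → Matrix.specialUnitaryGroup n ℂ) → ℝ} (hS : Measurable S) {s : ℝ} (hs : ∀ u, |S u| ≤ s)
    (h1 : N * ε ≤ sunShortTrajThreshold ι hinj) (h2 : (2 * N + 1) * b ≤ sunShortTrajThreshold ι hinj)
    (h3 : Kg * ε * (N : ℝ) ^ 2 ≤ sunShortTrajThreshold ι hinj) :
    ∃ k : ℕ, ∃ δ : ℝ, 0 < δ ∧ δ ≤ 1 ∧ ∀ (μ₀ : Measure (L → Matrix.specialUnitaryGroup n ℂ))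
      [IsProbabilityMeasure μ₀] (t : ℕ) (A : Set (L → Matrix.specialUnitaryGroup n ℂ)),
      |((fun m : Measure (L → Matrix.specialUnitaryGroup n ℂ) => m.bind (sunLeapfrogHMCN ι hι ε μ T hg S N))^[t] μ₀).real A
          - (gibbsProbability (Measure.pi fun _ : L => haarProbability (Matrix.specialUnitaryGroup n ℂ))
              (fun u => Real.exp (-S u))).real A| ≤ (1 - δ) ^ (t / (k + 1)) := by
  obtain ⟨hlo, hhi⟩ := gibbsWeight_pinched (L := L) (n := n) hs
  haveI := isProbabilityMeasure_gibbsProbability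
    (μ := Measure.pi fun _ : L => haarProbability (Matrix.specialUnitaryGroup n ℂ)) (Real.exp_pos (-s)) hlo hhi
  haveI := isProbabilityMeasure_sunMomentumLaw (L := L) μ T hT hZ
  have hH : Measurable fun z : (L → Matrix.specialUnitaryGroup n ℂ) × (L → E) => S z.1 + T z.2 :=
    (hS.comp measurable_fst).add (hT.comp measurable_snd)
  haveI : Fact (Measurable fun z : (L → Matrix.specialUnitaryGroup n ℂ) × (L → E) => S z.1 + T z.2) := ⟨hH⟩
  haveI : IsMarkovKernel (sunLeapfrogHMCN ι hι ε μ T hg S N) := by unfold sunLeapfrogHMCN; infer_instance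
  obtain ⟨k, δ, hδ0, hmin⟩ := sunLeapfrogHMCN_nHit_minorised ι hι hinj μ hsurj hε hN hT hT0 hTle hZ hg hb0 hb hK0 hK hS hs h1 h2 h3
  haveI : IsMarkovKernel (nHit (sunLeapfrogHMCN ι hι ε μ T hg S N) (k + 1)) := isMarkovKernel_nHit _ _
  have hδ1 : δ ≤ 1 := by
    have h := Measure.le_iff'.1 (hmin fun _ => 1) univ
    rwa [Measure.smul_apply, smul_eq_mul, measure_univ, measure_univ, mul_one] at h
  have hδtop : δ ≠ ⊤ := ne_top_of_le_ne_top ENNReal.one_ne_top hδ1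
  refine ⟨k, δ.toReal, ENNReal.toReal_pos hδ0.ne' hδtop,
    ENNReal.toReal_le_of_le_ofReal zero_le_one (by rwa [ENNReal.ofReal_one]), fun μ₀ _ t A => ?_⟩
  exact uniformlyErgodic_of_nHit_minorised hmin (sunLeapfrogHMCN_invariant_gibbs ι hι hg hT hZ hS N) μ₀ t A

/-- **The Gibbs law is the unique invariant probability law** of `n`-step leapfrog HMC on `SU(N)^links`
for short trajectories (same hypotheses). -/
theorem sunLeapfrogHMCN_invariant_unique
    (hsurj : ∀ X : Matrix n n ℂ, Xᴴ = -X → X.trace = 0 → X ∈ LinearMap.range ι)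
    {ε : ℝ} (hε : 0 < ε) {N : ℕ} (hN : 1 ≤ N) (hT : Measurable T) (hT0 : ∀ p, 0 ≤ T p)
    (hTle : ∀ (R : ℝ) (p : L → E), (∀ l, ‖p l‖ ≤ R) → T p ≤ τ R) (hZ : sunMomentumWeight (L := L) μ T univ ≠ ⊤)
    (hg : Measurable g) {b Kg : ℝ} (hb0 : 0 ≤ b) (hb : ∀ u l, ‖g u l‖ ≤ b) (hK0 : 0 ≤ Kg)
    (hK : ∀ U U', ‖g U - g U'‖ ≤ Kg * ‖coeConfig U - coeConfig U'‖)
    {S : (L → Matrix.specialUnitaryGroup n ℂ) → ℝ} (hS : Measurable S) {s : ℝ} (hs : ∀ u, |S u| ≤ s)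
    (h1 : N * ε ≤ sunShortTrajThreshold ι hinj) (h2 : (2 * N + 1) * b ≤ sunShortTrajThreshold ι hinj)
    (h3 : Kg * ε * (N : ℝ) ^ 2 ≤ sunShortTrajThreshold ι hinj)
    {π' : Measure (L → Matrix.specialUnitaryGroup n ℂ)} [IsProbabilityMeasure π']
    (hπ' : Invariant (sunLeapfrogHMCN ι hι ε μ T hg S N) π') :
    π' = gibbsProbability (Measure.pi fun _ : L => haarProbability (Matrix.specialUnitaryGroup n ℂ))
      (fun u => Real.exp (-S u)) := by
  obtain ⟨hlo, hhi⟩ := gibbsWeight_pinched (L := L) (n := n) hs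
  haveI := isProbabilityMeasure_gibbsProbability
    (μ := Measure.pi fun _ : L => haarProbability (Matrix.specialUnitaryGroup n ℂ)) (Real.exp_pos (-s)) hlo hhi
  haveI := isProbabilityMeasure_sunMomentumLaw (L := L) μ T hT hZ
  have hH : Measurable fun z : (L → Matrix.specialUnitaryGroup n ℂ) × (L → E) => S z.1 + T z.2 :=
    (hS.comp measurable_fst).add (hT.comp measurable_snd)
  haveI : Fact (Measurable fun z : (L → Matrix.specialUnitaryGroup n ℂ) × (L → E) => S z.1 + T z.2) := ⟨hH⟩
  haveI : IsMarkovKernel (sunLeapfrogHMCN ι hι ε μ T hg S N) := by unfold sunLeapfrogHMCN; infer_instance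
  obtain ⟨k, δ, hδ0, hmin⟩ := sunLeapfrogHMCN_nHit_minorised ι hι hinj μ hsurj hε hN hT hT0 hTle hZ hg hb0 hb hK0 hK hS hs h1 h2 h3
  haveI : IsMarkovKernel (nHit (sunLeapfrogHMCN ι hι ε μ T hg S N) (k + 1)) := isMarkovKernel_nHit _ _
  exact invariant_unique_of_minorised hmin hδ0
    (invariant_nHit (sunLeapfrogHMCN_invariant_gibbs ι hι hg hT hZ hS N) (k + 1)) (invariant_nHit hπ' (k + 1))

end SUN

end Summit.Ventures.LatticeQCDFlow.Exactness
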